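import Summits.QuantumFields.YangMills.Theorems.BalabanUVNodesK0RecordFormatNamesFluctD
import Literature.MathematicalPhysics.QuantumFieldTheory.Balaban1983to89.B15AveragingHolomorphic

/-!
# NODE O port PT-A — OBJECTS OF THE δ-JACOBIAN SUB-HALF's ROW (a): complex `su2Gen`-coordinates, the HOLOMORPHIC `b₀`-block `A₁^ℂ(c)(W)` of a matrix field (response of the tree's
# ℂ-differentiable (0.4) model `B15AveragingHolomorphic.avgMh` in the private coordinate `b₀(c)`, times `(avgMh W c)⁻¹`), and the holomorphic Jacobian factor `log det A₁^ℂ(c)(W)`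

Cell `ym-nodeO-ideate`, porter seat `ymgap-nodeO-port-PTA-1` (gen 5); DEFINITION file (objects the line posits for `stub_LZjac` of 27930's skeleton `pta_residueW`, PORT-PLAN-v5 §4), `--supports
stmt-QuantumFields-27930`.  [I] = [Balaban1987RG1], [15] = [Balaban1985Variational].
WHY.  Row (a) of the residue asks the pieces to be ANALYTIC functions of the complex pairs of (1.11)–(1.16); the Jacobian factor `log|det A₁(c)(V^{(k)})|` of `phiLZjac` (✓p812199) is built from
DEF-1's REAL objects (`recordLQtB0`, an `fderiv ℝ`).  Its holomorphic extension is typed here over the tree's adjugate-based model `avgMh` (✓ `B15AveragingHolomorphic`: ℂ-differentiable, `= avgM` on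
`SU(N)` fields) in complex coordinates against the SAME basis `su2Gen` (so that at `SU(2)` fields it coincides with the real block — the companion proof file).  Generic over the torus `P` and the
level `j` (the reference-torus packaging of row (e) will instantiate it on a fixed torus).
* `su2CoordC M` — the coordinates `z ∈ ℂ³` with `M = Σ_a z_a su2Gen a` for traceless `M` (`= su2Coord M` on 𝔰𝔲(2)).
* `jacBlockC c W` — `A₁^ℂ(c)(W)_{ia} := su2CoordC_i (D_ℂ avgMh(W)[su2Gen a · W(b₀(c)) · δ_{b₀(c)}] (c) · (avgMh W c)⁻¹)`.
* `jacFactorC c W := Complex.log (det A₁^ℂ(c)(W))` (principal branch; near the flat value `(N_c∕|I|)³ > 0` it is the analytic continuation of `log|det A₁(c)|`).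

HONEST FRAMING.  Definitions only; NOTHING of Bałaban asserted or proved; `stub_LZjac` OPEN; 27930 OPEN · no claim; K0⁷∕K-Ax OPEN; NODE O 0∕1; COUNT 8∕28 · K 1∕4 UNMOVED; finite `𝕋⁴_{L^K}` at fixed ε —
NOT continuum ∕ OS ∕ Clay; **the Yang–Mills mass gap is NOT proved by any of this.**  No `sorry`, no `instance`, no `notation`; standard axioms.
-/

noncomputable section

open scoped BigOperators Matrix.Norms.L2Operator Topology

namespace Summit.QuantumFields.YangMills.Theorems.BalabanUVNodesPortS1

open Summit.QuantumFields.YangMills.Theorems.K0RecordFormatNames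
open Literature.MathematicalPhysics.QuantumFieldTheory.Balaban1983to89
open Literature.MathematicalPhysics.QuantumFieldTheory.Balaban1983to89.Node00
open Literature.MathematicalPhysics.QuantumFieldTheory.Balaban1983to89.BlockAveragingHaarAC (centralBond)
open Literature.MathematicalPhysics.QuantumFieldTheory.Balaban1983to89.B15AveragingHolomorphic (avgMh)
open _root_.Matrix

/-- **Complex coordinates against `su2Gen`**: for a traceless `M ∈ M₂(ℂ)` the unique `z ∈ ℂ³` with `M = Σ_a z_a • su2Gen a` (`z = (−i(M₀₁+M₁₀)∕2, (M₀₁−M₁₀)∕2, −iM₀₀)`); on 𝔰𝔲(2) it is the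
real `su2Coord`. [cite: Balaban1987RG1, (1.10) p.262 («Gᶜ-valued»), (2.4) p.266 (bookkeeping)] -/
def su2CoordC (M : MatA 2) : Fin 3 → ℂ := ![-Complex.I * (M 0 1 + M 1 0) / 2, (M 0 1 - M 1 0) / 2, -Complex.I * M 0 0]

variable {P : Params} {j : ℕ}

/-- ★ **THE HOLOMORPHIC `b₀`-BLOCK `A₁^ℂ(c)(W)`** of a matrix field `W` on the level-`j` bonds: the complex `su2Gen`-coordinates of the response of the holomorphic (0.4) average `avgMh` at `c` to the
tangent direction `su2Gen a · W(b₀(c))` on the central bond, read at `c` and multiplied by `(avgMh W c)⁻¹` — the holomorphic extension of the `c`-block of `LQ̃` (at `SU(2)` fields in the guard it is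
DEF-1's `recordLQtB0` block, companion proof file). [cite: Balaban1987RG1, p.267 («h(c)»), (0.4) p.253; Balaban1985Variational, Prop. 9 p.309 («extension to an analytic function of Gᶜ-valued … configurations»)] -/
def jacBlockC (c : PBond P (j + 1)) (W : PBond P j → MatA 2) : Matrix (Fin 3) (Fin 3) ℂ :=
  Matrix.of fun i a => su2CoordC (fderiv ℂ (avgMh : (PBond P j → MatA 2) → PBond P (j + 1) → MatA 2) W
    (Pi.single (centralBond c) (su2Gen a * W (centralBond c))) c * (avgMh W c)⁻¹) i

/-- ★ **THE HOLOMORPHIC JACOBIAN FACTOR** `log det A₁^ℂ(c)(W)` (principal branch of the complex logarithm; the piece of `stub_LZjac` before the reference-torus packaging).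
[cite: Balaban1987RG1, p.268 («we eliminate the variables B′(b₀(c))»), (1.18) p.263] -/
def jacFactorC (c : PBond P (j + 1)) (W : PBond P j → MatA 2) : ℂ := Complex.log (jacBlockC c W).det

end Summit.QuantumFields.YangMills.Theorems.BalabanUVNodesPortS1

end
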